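import Literature.MathematicalPhysics.QuantumFieldTheory.Balaban1983to89.T4FlagMemory

/-!
# `Balaban1983to89.T4FlagMemoryPolyWeight` — node U2 / NE4 (P1 side): the typed FADING-MEMORY CLASS
`T4CouplingMatching.FadingMemory C θ Λ` (`Λ k i ≤ C·θ^(k−i)`) ABSORBS POLYNOMIAL PREFACTORS `(1 + (k − i))^p` at the
cost of any slower rate θ′ > θ, with EXPLICIT class constants for p = 1 (`C·θ′/(θ′−θ)`) and p = 2
(`2C·(θ′/(θ′−θ))²`) and an existential one for every p — a CLASS-ROBUSTNESS lemma (kernel; elementary real analysis,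
[folklore]) motivated by the SHAPE of the one printed history-versus-generation-decay computation,
[Balaban1989LargeFieldII] (1.47) p. 368 (cell `pub-balaban`, T4-DAG v21 §2 node U2 / §6 NE4; journal row
T4-U2.NE4-PROVE-P1h*; NO estimate of the cell's NEW-ESTIMATE kind).

HONEST FRAMING (T4-DAG PAGE 1).  The cell's T4 target is the existence AND uniqueness of the continuum limit of
Bałaban's unit-scale expectations on a FIXED FINITE torus T⁴ (rung (B)+1): NOT infinite volume, NOT the Yang–Mills
mass gap, NOT the Clay problem.  This module is NOT summit progress and proves NO estimate about Bałaban's objects: it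
proves elementary facts about the typed HYPOTHESIS CLASS in which node U2 states the fading memory of the coupling
history (`T4CouplingMatching.FadingMemory`, used for the functional-memory modulus `M′` of `T4FlagMemory.StepMemory`
and for the history moduli `Λ` of `T4CouplingMatching.HistLipschitz`).  Those hypotheses are NOT PRINTED (register
`t4/CITED-FACTS-T4.md` §2 NE4; GAPS G-b12g6-1 / G-t4-U2R-1; record `t4/T4-EST-NE4-P1.md` §8 item I3) and stay so.

WHY THIS MODULE (the located printed ANALOGUE and its shape).  The T⁴ citation register (unit `b2b-balaban-t4-lit1`,
CITED-FACTS-T4 v1.17 entries F-T4-219, F-T4-220, F-T4-221, journal NOTE l.53052) located the ONE place in the papers under audit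
where a coupling-HISTORY term is summed against decay in the generation gap, and this unit read the three pages
FIRST-HAND on the cell's renders (`b2b-balaban-ref1/pages/1989-cmp122-large-field-II/1989-cmp122-large-field-II-p010-x2.png`,
`-p011-x2.png`, `-p014-x2.png`; journal page = PDF page + 354).  Verbatim ([Balaban1989LargeFieldII] = T. Bałaban,
*Large field renormalization. II. Localization, exponentiation, and bounds for the 𝐑 operation*, Commun. Math. Phys.
**122**, 355–392 (1989), cell paper B16):
 * p. 364 (after (1.32)): «We have to notice only that (1/(g″_k(·))²) − 1/g_k² is bounded by O(1)(k − j) on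
   Ω″_j∖Ω″_{j+1}, and the exponential decay of H″_{k,Z} suppresses this bound.»
 * p. 365 (after (1.35)): «We define also the new function 1/(g_k(·))² = 1/(g″_k(·))²Z^c + 1/(g_k²)Z. We use here
   and above the same notation for a set, and for its characteristic function.»
 * p. 368 (after (1.46)): «The argument of the function 𝐇″_{h+2} has a support in the domain Ω″^{~2}_{h+1}∩Z″_{h+2}.
   This is very important, because the exponential decay of this function suppresses strongly large values of
   1/(g″_k(·))².», and the middle members of (1.47): «≤ O(1)(1/g_k²)(α_{0,k} + α_{1,k})ε_kL^{−N}N^{1+β₀}·B₃³B₅M⁶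
   Σ_{j=1}^h Σ_{x∈Γ″_j} exp(−½δd(x, Ω″^{~2}_{h+1}))exp(−½δM(h − j))(1 + h − j)^{1+β₀} ≤
   O(1)A₀C₁B₃³B₅M⁶p₀(g_k)q₁(g_k)R_k²L^{−N}|Γ″_h∩Ω″^{~2}_{h+1}|».
WHAT THE PRINTED COMPUTATION IS AND IS NOT.  It bounds the SIZE of ONE term of ONE expansion of ONE model at ONE
lattice spacing, by SPATIAL exponential decay of 𝐇″ against the nested large-field geometry (Γ″_j lies at distance
≳ M(h − j) from Ω″^{~2}_{h+1}); it is NOT a modulus of continuity of E^{(k)} or of β_k in the older couplings and it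
compares nothing at two spacings — hence an ANALOGUE of `StepMemory` / `FadingMemory` only (register tag P1; GAPS
C-ne4p1-22).  What it DOES exhibit is the SHAPE a generation-gap profile takes in print: a geometric factor `ω^m`
(ω = e^{−½δM}, m = h − j) times a POLYNOMIAL prefactor `(1 + m)^{1+β₀}` (the coupling drift «O(1)(k − j)» of p. 364
and the N-window exponent).  The typed class is purely geometric.  This module checks in the kernel that the
difference is immaterial for node U2: a profile `C·(1 + m)^p·θ^m` lies in `FadingMemory C′ θ′` for EVERY θ′ ∈ ]θ, ∞[
(θ ≥ 0), with explicit C′ for p ≤ 2 (every printed exponent 1 + β₀ ≤ 2 is covered by p = 2 through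
`(1 + m)^{1+β₀} ≤ (1 + m)²`), so a functional-memory modulus of the printed shape enters `T4FlagMemory.ne4_of_scheme`
(§3 probe, BY NAME) — and through its output the downstream node-U2 consumers — unchanged, the rate loss θ → θ′ being
paid inside node U2's window `(1 + C′)θ′ < ρ`.  Nothing here narrows the lineage wall (M) ⇐ node U3's (A)+(B′)+(C)
(record §0/§1): the instance of `ClusterGeom.PotentialKP` for the (2.14)-activities is still owed by node U3.

CONTENT (all [folklore]; kernel-checked, no `sorry`, standard axioms).
 §1 `succ_mul_pow_le`            `(m+1)·s^m ≤ 1/(1−s)`                       (0 ≤ s < 1)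
    `weighted_geom_sum_identity` `(1−s)²·Σ_{i<n}(i+1)s^i = 1 − (n+1)s^n + n·s^(n+1)`
    `succ_sq_mul_pow_le`         `(m+1)²·s^m ≤ 2/(1−s)²`                    (0 ≤ s < 1)
    `exists_bound_succ_pow_mul_pow`  `∃ B ≥ 1, ∀ m, (m+1)^p·s^m ≤ B`         (0 ≤ s < 1, any p : ℕ)
 §2 `fadingMemory_of_linGeom`    profile `C(1+m)θ^m`   ⇒ `FadingMemory (C·(θ′/(θ′−θ))) θ′ Λ`        (0 ≤ θ < θ′)
    `fadingMemory_of_sqGeom`     profile `C(1+m)²θ^m`  ⇒ `FadingMemory (2C·(θ′/(θ′−θ))²) θ′ Λ`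
    `fadingMemory_of_polyGeom`   profile `C(1+m)^pθ^m` ⇒ `∃ C′ ≥ 0, FadingMemory C′ θ′ Λ`
    `polyGeom_of_fadingMemory`   conversely nothing is lost — a `FadingMemory C θ` profile is a p-profile.
 §3 `Probes`: `T4FlagMemory.ne4_of_scheme` fired BY NAME on a one-step scheme whose functional memory `M′` has the
    printed (p = 2) shape at rate ω, at any intermediate rate ω′ ∈ ]ω, ∞[ inside the window `(1 + C″)ω′ < ρ`.

CITATION HEADER (lean-in-tree rule 2026-08-18).  The four «…» spans above (B16 pp. 364, 365, 368) are the ONLY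
passages quoted in this module; they were read first-hand by this unit on the named renders and agree character for
character with the register entries F-T4-219, F-T4-220, F-T4-221 of `t4/CITED-FACTS-T4.md` v1.17 (unit t4-lit1); they are
MOTIVATION for the shape `(1+m)^p θ^m` and are NOT used as hypotheses — every theorem below is elementary real
analysis proved here.  ABSOLUTE RULE: no internally-minted statement and no step of the manuscripts under audit enters
as a cited fact.  The Bałaban papers are manuscripts UNDER ADJUDICATION by the audit cell `pub-balaban`: NOTHING
printed in them is asserted here.  NEW module of unit `b2b-balaban-t4-ne4-p1-g10` (NE4 prover P1, gen 10; journal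
CLAIM T4-U2.NE4-PROVE-P1h* l.53478); imports the tree module `T4FlagMemory` (this lineage) and through it
`T4CouplingMatching`, `T4BetaMemory`, `FlowStep` BY NAME, and modifies nothing.
-/

namespace Literature.MathematicalPhysics.QuantumFieldTheory.Balaban1983to89.T4FlagMemoryPolyWeight

open Literature.MathematicalPhysics.QuantumFieldTheory.Balaban1983to89
open Literature.MathematicalPhysics.QuantumFieldTheory.Balaban1983to89.FlowStep
open Literature.MathematicalPhysics.QuantumFieldTheory.Balaban1983to89.T4CouplingMatching (FadingMemory ScaleShiftRate
  HistLipschitz)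
open Literature.MathematicalPhysics.QuantumFieldTheory.Balaban1983to89.T4FlagMemory
open Filter Topology Finset
open scoped BigOperators

/-! ## §1  Polynomial prefactors against a geometric factor: explicit bounds for p ≤ 2, a bound for every p -/

section Elementary

/-- `(m+1)·s^m ≤ 1/(1−s)` for `0 ≤ s < 1`: `(m+1)s^m ≤ Σ_{i≤m} s^i = (1 − s^{m+1})/(1 − s)`. [folklore] -/
theorem succ_mul_pow_le {s : ℝ} (hs0 : 0 ≤ s) (hs1 : s < 1) (m : ℕ) :
    ((m : ℝ) + 1) * s ^ m ≤ 1 / (1 - s) := by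
  have h1s : 0 < 1 - s := sub_pos.2 hs1
  have hsum : ((m : ℝ) + 1) * s ^ m ≤ ∑ i ∈ range (m + 1), s ^ i := by
    have e : ((m : ℝ) + 1) * s ^ m = ∑ _i ∈ range (m + 1), s ^ m := by
      rw [sum_const, card_range, nsmul_eq_mul]; push_cast; ring
    rw [e]
    exact sum_le_sum fun i hi => pow_le_pow_of_le_one hs0 hs1.le (Nat.lt_succ_iff.1 (mem_range.1 hi))
  have hgeom : (∑ i ∈ range (m + 1), s ^ i) * (1 - s) = 1 - s ^ (m + 1) := geom_sum_mul_neg s (m + 1)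
  rw [le_div_iff₀ h1s]
  calc ((m : ℝ) + 1) * s ^ m * (1 - s) ≤ (∑ i ∈ range (m + 1), s ^ i) * (1 - s) :=
        mul_le_mul_of_nonneg_right hsum h1s.le
    _ = 1 - s ^ (m + 1) := hgeom
    _ ≤ 1 := by linarith [pow_nonneg hs0 (m + 1)]

/-- `(1−s)²·Σ_{i<n}(i+1)s^i = 1 − (n+1)s^n + n·s^{n+1}` (the derivative of the geometric sum, as a polynomial
identity). [folklore] -/
theorem weighted_geom_sum_identity (s : ℝ) (n : ℕ) :
    (1 - s) ^ 2 * ∑ i ∈ range n, ((i : ℝ) + 1) * s ^ i = 1 - ((n : ℝ) + 1) * s ^ n + n * s ^ (n + 1) := by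
  induction n with
  | zero => simp
  | succ n ih =>
    rw [sum_range_succ, mul_add, ih]
    push_cast
    ring

/-- `2·Σ_{i<n}(i+1) = n(n+1)`. [folklore] -/
theorem two_mul_sum_succ (n : ℕ) : 2 * ∑ i ∈ range n, ((i : ℝ) + 1) = n * ((n : ℝ) + 1) := by
  induction n with
  | zero => simp
  | succ n ih =>
    rw [sum_range_succ, mul_add, ih]
    push_cast
    ring

/-- `(m+1)²·s^m ≤ 2/(1−s)²` for `0 ≤ s < 1`: `(m+1)² s^m ≤ (m+1)(m+2) s^m = 2Σ_{i≤m}(i+1)s^m ≤ 2Σ_{i≤m}(i+1)s^i`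
and `(1−s)²Σ_{i≤m}(i+1)s^i = 1 − s^{m+1} − (m+1)s^{m+1}(1−s) ≤ 1`.  Covers every printed exponent `1 + β₀ ≤ 2` of
[Balaban1989LargeFieldII] (1.47) p. 368 through `(1+m)^{1+β₀} ≤ (1+m)²`. [folklore] -/
theorem succ_sq_mul_pow_le {s : ℝ} (hs0 : 0 ≤ s) (hs1 : s < 1) (m : ℕ) :
    ((m : ℝ) + 1) ^ 2 * s ^ m ≤ 2 / (1 - s) ^ 2 := by
  have h1s : 0 < 1 - s := sub_pos.2 hs1
  have h1s2 : 0 < (1 - s) ^ 2 := pow_pos h1s 2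
  set S : ℝ := ∑ i ∈ range (m + 1), ((i : ℝ) + 1) * s ^ i with hS
  -- (m+1)² s^m ≤ 2 S
  have hlow : ((m : ℝ) + 1) ^ 2 * s ^ m ≤ 2 * S := by
    have hterm : ∑ i ∈ range (m + 1), ((i : ℝ) + 1) * s ^ m ≤ S :=
      sum_le_sum fun i hi => mul_le_mul_of_nonneg_left
        (pow_le_pow_of_le_one hs0 hs1.le (Nat.lt_succ_iff.1 (mem_range.1 hi))) (by positivity)
    have e : ∑ i ∈ range (m + 1), ((i : ℝ) + 1) * s ^ m = (∑ i ∈ range (m + 1), ((i : ℝ) + 1)) * s ^ m := by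
      rw [sum_mul]
    have h2 : 2 * ∑ i ∈ range (m + 1), ((i : ℝ) + 1) = (m + 1 : ℕ) * (((m + 1 : ℕ) : ℝ) + 1) :=
      two_mul_sum_succ (m + 1)
    have hsq : ((m : ℝ) + 1) ^ 2 ≤ 2 * ∑ i ∈ range (m + 1), ((i : ℝ) + 1) := by
      rw [h2]; push_cast; nlinarith
    calc ((m : ℝ) + 1) ^ 2 * s ^ m ≤ (2 * ∑ i ∈ range (m + 1), ((i : ℝ) + 1)) * s ^ m :=
          mul_le_mul_of_nonneg_right hsq (pow_nonneg hs0 m)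
      _ = 2 * ∑ i ∈ range (m + 1), ((i : ℝ) + 1) * s ^ m := by rw [e]; ring
      _ ≤ 2 * S := by linarith
  -- (1-s)² S ≤ 1
  have hup : (1 - s) ^ 2 * S ≤ 1 := by
    rw [hS, weighted_geom_sum_identity s (m + 1)]
    have hsm : 0 ≤ s ^ (m + 1) := pow_nonneg hs0 _
    have : (((m + 1 : ℕ) : ℝ) + 1) * s ^ (m + 1) - (m + 1 : ℕ) * s ^ (m + 1 + 1) ≥ 0 := by
      rw [pow_succ s (m + 1)]
      push_cast
      have h1s' : 0 ≤ 1 - s := h1s.le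
      nlinarith [mul_nonneg hsm h1s', mul_nonneg (mul_nonneg (Nat.cast_nonneg m : (0 : ℝ) ≤ m) hsm) h1s']
    linarith
  rw [le_div_iff₀ h1s2]
  calc ((m : ℝ) + 1) ^ 2 * s ^ m * (1 - s) ^ 2 ≤ 2 * S * (1 - s) ^ 2 :=
        mul_le_mul_of_nonneg_right hlow h1s2.le
    _ = 2 * ((1 - s) ^ 2 * S) := by ring
    _ ≤ 2 := by linarith

/-- For every `p : ℕ` and `0 ≤ s < 1` the sequence `(m+1)^p s^m` is bounded (it tends to 0,
`tendsto_pow_const_mul_const_pow_of_abs_lt_one`); the bound is chosen `≥ 1` (= its value at m = 0). [folklore] -/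
theorem exists_bound_succ_pow_mul_pow {s : ℝ} (hs0 : 0 ≤ s) (hs1 : s < 1) (p : ℕ) :
    ∃ B : ℝ, 1 ≤ B ∧ ∀ m : ℕ, ((m : ℝ) + 1) ^ p * s ^ m ≤ B := by
  have ht := tendsto_pow_const_mul_const_pow_of_abs_lt_one p (abs_lt.2 ⟨by linarith, hs1⟩)
  obtain ⟨B₀, hB₀⟩ := ht.bddAbove_range
  refine ⟨max 1 (2 ^ p * B₀), le_max_left _ _, fun m => ?_⟩
  rcases Nat.eq_zero_or_pos m with rfl | hm
  · simp only [Nat.cast_zero, zero_add, one_pow, pow_zero, mul_one]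
    exact le_max_left _ _
  · have hm1 : (1 : ℝ) ≤ m := by exact_mod_cast hm
    have h1 : ((m : ℝ) + 1) ^ p ≤ (2 * (m : ℝ)) ^ p :=
      pow_le_pow_left₀ (by positivity) (by linarith) p
    have h2 : (m : ℝ) ^ p * s ^ m ≤ B₀ := hB₀ ⟨m, rfl⟩
    calc ((m : ℝ) + 1) ^ p * s ^ m ≤ (2 * (m : ℝ)) ^ p * s ^ m :=
          mul_le_mul_of_nonneg_right h1 (pow_nonneg hs0 _)
      _ = 2 ^ p * ((m : ℝ) ^ p * s ^ m) := by rw [mul_pow]; ring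
      _ ≤ 2 ^ p * B₀ := mul_le_mul_of_nonneg_left h2 (by positivity)
      _ ≤ max 1 (2 ^ p * B₀) := le_max_right _ _

end Elementary

/-! ## §2  The fading-memory class absorbs polynomial prefactors at any slower rate -/

section Class

/-- Rate splitting: `θ^m = (θ/θ′)^m · θ′^m` for `θ′ ≠ 0`. [folklore] -/
theorem pow_eq_ratio_pow_mul {θ θ' : ℝ} (hθ' : θ' ≠ 0) (m : ℕ) : θ ^ m = (θ / θ') ^ m * θ' ^ m := by
  rw [← mul_pow, div_mul_cancel₀ θ hθ']

/-- **p = 1, explicit.**  A profile `0 ≤ Λ k i ≤ C·(1 + (k−i))·θ^(k−i)` (`0 ≤ C`, `0 ≤ θ < θ′`) lies in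
`FadingMemory (C·(θ′/(θ′−θ))) θ′`: `(m+1)(θ/θ′)^m ≤ 1/(1 − θ/θ′) = θ′/(θ′−θ)`. [folklore] -/
theorem fadingMemory_of_linGeom {C θ θ' : ℝ} {Λ : ℕ → ℕ → ℝ} (hC : 0 ≤ C) (hθ : 0 ≤ θ) (hθ' : θ < θ')
    (h : ∀ k i, i ≤ k → 0 ≤ Λ k i ∧ Λ k i ≤ C * ((((k - i : ℕ)) : ℝ) + 1) * θ ^ (k - i)) :
    FadingMemory (C * (θ' / (θ' - θ))) θ' Λ := by
  have hθ'0 : 0 < θ' := lt_of_le_of_lt hθ hθ'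
  have hs0 : 0 ≤ θ / θ' := div_nonneg hθ hθ'0.le
  have hs1 : θ / θ' < 1 := (div_lt_one hθ'0).2 hθ'
  have hinv : 1 / (1 - θ / θ') = θ' / (θ' - θ) := by
    field_simp
  intro k i hik
  refine ⟨(h k i hik).1, ?_⟩
  have hb : ((((k - i : ℕ)) : ℝ) + 1) * (θ / θ') ^ (k - i) ≤ θ' / (θ' - θ) :=
    hinv ▸ succ_mul_pow_le hs0 hs1 (k - i)
  calc Λ k i ≤ C * ((((k - i : ℕ)) : ℝ) + 1) * θ ^ (k - i) := (h k i hik).2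
    _ = C * (((((k - i : ℕ)) : ℝ) + 1) * (θ / θ') ^ (k - i)) * θ' ^ (k - i) := by
        rw [pow_eq_ratio_pow_mul hθ'0.ne' (k - i)]; ring
    _ ≤ C * (θ' / (θ' - θ)) * θ' ^ (k - i) :=
        mul_le_mul_of_nonneg_right (mul_le_mul_of_nonneg_left hb hC) (pow_nonneg hθ'0.le _)

/-- **p = 2, explicit (covers the printed exponent 1 + β₀ ≤ 2).**  A profile `0 ≤ Λ k i ≤ C·(1 + (k−i))²·θ^(k−i)`
(`0 ≤ C`, `0 ≤ θ < θ′`) lies in `FadingMemory (2C·(θ′/(θ′−θ))²) θ′`. [folklore] -/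
theorem fadingMemory_of_sqGeom {C θ θ' : ℝ} {Λ : ℕ → ℕ → ℝ} (hC : 0 ≤ C) (hθ : 0 ≤ θ) (hθ' : θ < θ')
    (h : ∀ k i, i ≤ k → 0 ≤ Λ k i ∧ Λ k i ≤ C * ((((k - i : ℕ)) : ℝ) + 1) ^ 2 * θ ^ (k - i)) :
    FadingMemory (2 * C * (θ' / (θ' - θ)) ^ 2) θ' Λ := by
  have hθ'0 : 0 < θ' := lt_of_le_of_lt hθ hθ'
  have hs0 : 0 ≤ θ / θ' := div_nonneg hθ hθ'0.le
  have hs1 : θ / θ' < 1 := (div_lt_one hθ'0).2 hθ'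
  have hinv : 2 / (1 - θ / θ') ^ 2 = 2 * (θ' / (θ' - θ)) ^ 2 := by
    have hne : θ' - θ ≠ 0 := sub_ne_zero.2 hθ'.ne'
    field_simp
  intro k i hik
  refine ⟨(h k i hik).1, ?_⟩
  have hb : ((((k - i : ℕ)) : ℝ) + 1) ^ 2 * (θ / θ') ^ (k - i) ≤ 2 * (θ' / (θ' - θ)) ^ 2 :=
    hinv ▸ succ_sq_mul_pow_le hs0 hs1 (k - i)
  calc Λ k i ≤ C * ((((k - i : ℕ)) : ℝ) + 1) ^ 2 * θ ^ (k - i) := (h k i hik).2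
    _ = C * (((((k - i : ℕ)) : ℝ) + 1) ^ 2 * (θ / θ') ^ (k - i)) * θ' ^ (k - i) := by
        rw [pow_eq_ratio_pow_mul hθ'0.ne' (k - i)]; ring
    _ ≤ C * (2 * (θ' / (θ' - θ)) ^ 2) * θ' ^ (k - i) :=
        mul_le_mul_of_nonneg_right (mul_le_mul_of_nonneg_left hb hC) (pow_nonneg hθ'0.le _)
    _ = 2 * C * (θ' / (θ' - θ)) ^ 2 * θ' ^ (k - i) := by ring

/-- **Every p.**  A profile `0 ≤ Λ k i ≤ C·(1 + (k−i))^p·θ^(k−i)` (`0 ≤ C`, `0 ≤ θ < θ′`, `p : ℕ`) lies in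
`FadingMemory C′ θ′` for some `C′ ≥ 0` (`C′ = C·B` with the bound `B` of `exists_bound_succ_pow_mul_pow`). [folklore] -/
theorem fadingMemory_of_polyGeom {C θ θ' : ℝ} {p : ℕ} {Λ : ℕ → ℕ → ℝ} (hC : 0 ≤ C) (hθ : 0 ≤ θ) (hθ' : θ < θ')
    (h : ∀ k i, i ≤ k → 0 ≤ Λ k i ∧ Λ k i ≤ C * ((((k - i : ℕ)) : ℝ) + 1) ^ p * θ ^ (k - i)) :
    ∃ C', 0 ≤ C' ∧ FadingMemory C' θ' Λ := by
  have hθ'0 : 0 < θ' := lt_of_le_of_lt hθ hθ'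
  have hs0 : 0 ≤ θ / θ' := div_nonneg hθ hθ'0.le
  have hs1 : θ / θ' < 1 := (div_lt_one hθ'0).2 hθ'
  obtain ⟨B, hB1, hB⟩ := exists_bound_succ_pow_mul_pow hs0 hs1 p
  refine ⟨C * B, mul_nonneg hC (by linarith), fun k i hik => ⟨(h k i hik).1, ?_⟩⟩
  calc Λ k i ≤ C * ((((k - i : ℕ)) : ℝ) + 1) ^ p * θ ^ (k - i) := (h k i hik).2
    _ = C * (((((k - i : ℕ)) : ℝ) + 1) ^ p * (θ / θ') ^ (k - i)) * θ' ^ (k - i) := by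
        rw [pow_eq_ratio_pow_mul hθ'0.ne' (k - i)]; ring
    _ ≤ C * B * θ' ^ (k - i) :=
        mul_le_mul_of_nonneg_right (mul_le_mul_of_nonneg_left (hB (k - i)) hC) (pow_nonneg hθ'0.le _)

/-- Conversely nothing is lost: a `FadingMemory C θ` profile is a p-profile with the same constant and rate (the
prefactor `(1+m)^p ≥ 1`), so for θ′ > θ the poly-weighted class and the geometric class generate the same hypotheses
up to the rate loss. [folklore] -/
theorem polyGeom_of_fadingMemory {C θ : ℝ} {Λ : ℕ → ℕ → ℝ} (hC : 0 ≤ C) (hθ : 0 ≤ θ) (p : ℕ)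
    (h : FadingMemory C θ Λ) :
    ∀ k i, i ≤ k → 0 ≤ Λ k i ∧ Λ k i ≤ C * ((((k - i : ℕ)) : ℝ) + 1) ^ p * θ ^ (k - i) := by
  intro k i hik
  refine ⟨(h k i hik).1, (h k i hik).2.trans ?_⟩
  have h1 : (1 : ℝ) ≤ ((((k - i : ℕ)) : ℝ) + 1) ^ p := one_le_pow₀ (le_add_of_nonneg_left (Nat.cast_nonneg _))
  have : C * θ ^ (k - i) * 1 ≤ C * θ ^ (k - i) * ((((k - i : ℕ)) : ℝ) + 1) ^ p :=
    mul_le_mul_of_nonneg_left h1 (mul_nonneg hC (pow_nonneg hθ _))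
  linarith

end Class

/-! ## §3  Probe: node U2's scheme theorem accepts a functional memory of the printed shape, BY NAME -/

namespace Probes

variable {X : Type*} [PseudoMetricSpace X] [Inhabited X]

/-- `T4FlagMemory.ne4_of_scheme` fired BY NAME on a one-step scheme whose functional-memory modulus `M′` has the
printed (p = 2) shape `C·(1 + (j−m))²·ω^(j−m)` at rate ω: NE4's three clauses follow at ANY rate ω′ ∈ ]ω, ∞[ for which
node U2's window `(1 + C″)ω′ < ρ` holds with the explicit class constant `C″ = 2C(ω′/(ω′−ω))²`.  The rate loss
ω → ω′ is the only price of the polynomial prefactor. [folklore] -/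
example {Φ : ℕ → ℝ → (ℕ → X) → X} {r : X → ℝ} {β : HBeta} {M' : ℕ → ℕ → ℝ}
    {src : ℕ → ℝ} {ℓ' C ω ω' γ cr a ρ : ℝ} (hℓ' : 0 ≤ ℓ') (hC : 0 ≤ C) (hω : 0 ≤ ω) (hωω' : ω < ω')
    (hcr : 0 ≤ cr) (ha : 0 ≤ a) (hsmall : (1 + 2 * C * (ω' / (ω' - ω)) ^ 2) * ω' < ρ)
    (hrep : Represents Φ r γ β) (hr : ReadLipschitz r cr) (hdir : StepDirect Φ ℓ' γ)
    (hmem : StepMemory Φ M')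
    (hM'poly : ∀ j m, m ≤ j → 0 ≤ M' j m ∧ M' j m ≤ C * ((((j - m : ℕ)) : ℝ) + 1) ^ 2 * ω ^ (j - m))
    (hsh : StepShift Φ γ src) (hsrc : ∀ k, src k ≤ a * ρ ^ k) :
    ScaleShiftRate (cr * (a * (ρ - ω') / (ρ - (1 + 2 * C * (ω' / (ω' - ω)) ^ 2) * ω'))) ρ γ β ∧
    HistLipschitz (fun k i => cr * ℓ' * ((1 + 2 * C * (ω' / (ω' - ω)) ^ 2) * ω') ^ (k - i)) γ β ∧
    FadingMemory (cr * ℓ') ρ (fun k i => cr * ℓ' * ((1 + 2 * C * (ω' / (ω' - ω)) ^ 2) * ω') ^ (k - i)) :=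
  ne4_of_scheme hℓ' (by positivity) (hω.trans hωω'.le) hcr ha hsmall hrep hr hdir hmem
    (fadingMemory_of_sqGeom hC hω hωω' hM'poly) hsh hsrc

/-- The explicit constants at the cell's illustrative numbers: rate ω = 1/4 slowed to ω′ = 1/2 costs the class
constant factor `θ′/(θ′−θ) = 2` (p = 1) resp. `2(θ′/(θ′−θ))² = 8` (p = 2). [folklore] -/
example : FadingMemory (1 * ((1 / 2 : ℝ) / (1 / 2 - 1 / 4))) (1 / 2)
    (fun k i => ((((k - i : ℕ)) : ℝ) + 1) * (1 / 4 : ℝ) ^ (k - i)) :=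
  fadingMemory_of_linGeom (C := 1) zero_le_one (by norm_num) (by norm_num)
    (fun k i _ => ⟨by positivity, by rw [one_mul]⟩)

example : (1 : ℝ) * ((1 / 2 : ℝ) / (1 / 2 - 1 / 4)) = 2 := by norm_num
example : 2 * (1 : ℝ) * ((1 / 2 : ℝ) / (1 / 2 - 1 / 4)) ^ 2 = 8 := by norm_num

end Probes

end Literature.MathematicalPhysics.QuantumFieldTheory.Balaban1983to89.T4FlagMemoryPolyWeight
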